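import Literature.NumberTheory.EllipticCurves.BhargavaHo2022.LargeFamilyCount
import Mathlib.Topology.Algebra.InfiniteSum.NatInt
import Mathlib.Data.Nat.Squarefree
import Mathlib.Tactic.NormNum.Prime
import HarnessLib

/-!
# Bhargava–Ho 2022, Theorem 9.1 for `F₂` WITH ITS MAIN-TERM CONSTANT (the Euler product of local
# densities), and its proved corollaries: relative density of a large subfamily = its Euler product,
# and the `p² ∣ Δ` TAIL ESTIMATE (squarefree sieve) for `F₂`

Topic `Literature/NumberTheory/EllipticCurves`, cluster `BhargavaHo2022`; companion of
`TwoMarkedPoints.lean` (the family `F₂`, `CongruenceFamily₂`, `IsLarge`, `below`) and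
`LargeFamilyCount.lean` (the named fact `thm9_1_F2`: Thm. 9.1 with only the POSITIVITY of its
constant). ONE named fact + proved corollaries; no instance, no notation.

Consumer (cell bsd-rank2, route `route-BirchSwinnertonDyer-CountingDoorF2AtThree`, cruxes I1
`SelmerThreeAverageLargeF2` / I2 `RootNumberPlusLowerDensityLargeF2`, stmt-BirchSwinnertonDyer-19440 /
-19441): the tree's sieve reductions `Theorems.selmerThreeAverageLargeF2_of_finiteConditions` /
`Theorems.rootNumberPlusLowerDensityLargeF2_of_finiteConditions` pass from families with FINITELY many
congruence conditions to every LARGE family modulo `thm9_1_F2` AND an explicit hypothesis `htail` — the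
`p² ∣ Δ` tail estimate «∀ η > 0 ∃ Y, eventually `#{a ∈ F₂(<X) : ∃ p ≥ Y prime, p² ∣ Δ(a)} ≤
η · #F₂(<X)`» — which `thm9_1_F2` (∃ `c_Φ > 0` only) cannot supply. With the printed CONSTANT it is a
corollary: the sieved family `F₂^{(Y)} = {a : p² ∤ Δ(a) for all primes p ≥ Y}` is large with relative
density `c_Y = ∏_{p ≥ Y} M_p(F₂^{(0)})` in `F₂`, and `c_Y → 1` because the full Euler product converges
to a POSITIVE number; this is exactly how Bhargava–Ho pass from Prop. 9.2 to Thm. 9.1 (proof of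
Thm. 8.7, p. 30: "`liminf ≥ … ∏_{p<Y} … − O_ε(1/(Y log Y)) − O(ε)`, letting `Y` tend to infinity").

**Source** (held, `paper:arxiv-2207.03309`; page = chunk): M. Bhargava, W. Ho, *On average sizes of
Selmer groups and ranks in families of elliptic curves having marked points*, arXiv:2207.03309 (2022)
[BhargavaHo2022]: §9.1 Thm. 9.1 (p0031 L9–L14, verbatim in the docstring below), §8.2 (p0026: the
local densities `M_p(Φ)`), Prop. 9.2 (p0031 L18–L23: the uniformity estimate for `F₂`), Thm. 9.6
(pp. 33–34: averages over large `Φ` divide by `M_p(Φ)`).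

## Contents
* named fact `thm9_1_F2_eulerProduct` — Thm. 9.1 for `F₂` with its constant `V · ∏_p M_p(Φ)`,
  `M_p(Φ) = #(residues p)/p^{4·expt p}` for a `CongruenceFamily₂`, the product a `HasProd` over `ℕ`
  (factors `1` at non-primes) with a positive value.
* PROVED (modulo the fact unless marked fact-free): `thm9_1_F2_eulerProduct.thm9_1` (the tree's
  `thm9_1_F2` follows); `.not_sq_dvd_Δ_witness`, `.exists_sievedFamilies` (fact-free: the sieved families
  `F₂^{(Y)}` as `CongruenceFamily₂`s — large at every prime, nonempty local conditions via the member
  `(1, 1, −1, 0)` of square-free discriminant `65`, membership characterised, local densities `1`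
  below `Y` and independent of `Y` from `Y` on); private `tail_eq_sdiff`, `card_tail_eq` (fact-free: the
  tail set is `F₂(<X) ∖ F₂^{(Y)}(<X)`); `.density_all_eq_one`, `.card_all_below_tendsto`
  (`#F₂(<X)/X^{2/3} → V`); `.relativeDensity` (relative density of a large `Φ` in `F₂` = its Euler
  product `> 0`); private `sievedDensity_tendsto_one` (real analysis); `.tail_estimate` (= the
  consumers' `htail`, verbatim).

PARTITION: none — cell bsd-rank2, r_an ≥ 2, summit axis S0; TWIN (D-0056): n/a. B1 honesty: counting
statements about a family of curves ordered by height; nothing here mentions an `L`-function, a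
Selmer group, a root number or the analytic rank.
-/

noncomputable section

open scoped Classical
open Filter Topology Finset

namespace Literature.NumberTheory.EllipticCurves.BhargavaHo2022

/-! ### Theorem 9.1 for `F₂` with its Euler-product constant (named fact) -/

/-- **Bhargava–Ho 2022, Thm. 9.1 for `F = F₂`, WITH ITS MAIN-TERM CONSTANT (the Euler product of the
local densities).** As printed (§9.1, p. 31): "Theorem 9.1. Let `Φ` be any large subfamily of `F`.
Then the number of elliptic curves `E` in `Φ` with `H(E) < X` is given by
`∫_{H(a⃗)<X} da⃗ · ∏_p M_p(Φ) · X^{n/k} + o(X^{n/k})`," where (§8.2, p. 26, the display after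
Prop. 8.1) "if `Φ` is a large subfamily of `F`, then we may define `M_p(Φ)` to be the measure of
`Φ_p^{inv}` with respect to the measure `da⃗` on `ℤ_p^m` … normalized so that the total measure is `1`.
That is, we have `M_p(Φ) = ∫_{E = E(a⃗) ∈ Φ_p} da⃗`", `n/k = 2/3` for `F₂` (p. 33, "`o(X^{2/3})`"), and
`∫_{H(a⃗)<X} da⃗ = Vol{H < 1} · X^{2/3}` by weighted homogeneity of the height. Transcription over the
tree's vocabulary (`CongruenceFamily₂` — at the prime `p` the local condition is «the residue of
`(a₁, a₂, a₂', a₃)` modulo `p ^ expt p` lies in `residues p`», so that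
`M_p(Φ) = #(residues p) / p^{4 · expt p}` —, `IsLarge`, `below`, the integer height `Params.height`):
there is a constant `V > 0` (the archimedean volume `Vol{H < 1}`, the same for every `Φ`) such that
for every large `Φ` whose local condition is nonempty at every prime — Bhargava–Ho's standing
assumption (Thm. 9.6 divides by `M_p(Φ)`), under which the Euler product `∏_p M_p(Φ)` converges to a
POSITIVE number (every factor is positive, and `M_p(Φ) = 1 − O(p⁻²)` for `p ≥ p₀` by largeness and
the uniformity estimate Prop. 9.2) — the Euler product has a value `c_Φ > 0` (as a `HasProd` over `ℕ`,
factors `1` at non-primes) and `#(Φ.below X) / X^{2/3} → V · c_Φ`. The tree's earlier transcription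
`Literature.NumberTheory.EllipticCurves.BhargavaHo2022.thm9_1_F2` keeps of the constant only
`c_Φ > 0`; this is the same printed theorem with its constant, which is what makes the RATIO of two
such counting functions computable (the relative density `∏_{p ≥ Y} (1 − μ_p{p² ∣ Δ})` of the sieved
family `{p² ∤ Δ(a), p ≥ Y}` in `F₂`, i.e. the `p² ∣ Δ` tail estimate). Named fact (D-0014): nothing is
asserted; users take `(h : thm9_1_F2_eulerProduct)`.
-- TODO(general form): `V = 12` for the tree's integer height; the families `F₀, F₁, F₁(2), F₁(3)`
-- of the same theorem.
[cite: BhargavaHo2022, Thm. 9.1 (§9.1, p. 31), with §8.2 (definition of M_p(Φ), p. 26), Prop. 9.2 (p. 31) and Thm. 9.6 (pp. 33–34)] -/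
def thm9_1_F2_eulerProduct : Prop :=
  ∃ V : ℝ, 0 < V ∧
    ∀ Φ : Literature.NumberTheory.EllipticCurves.BhargavaHo2022.CongruenceFamily₂, Φ.IsLarge →
      (∀ p : ℕ, p.Prime → (Φ.residues p).Nonempty) →
      ∃ c : ℝ, 0 < c ∧
        HasProd (fun p : ℕ ↦ if p.Prime then
            ((Φ.residues p).ncard : ℝ) / ((p : ℝ) ^ Φ.expt p) ^ 4 else 1) c ∧
        Filter.Tendsto (fun X : ℕ ↦ ((Φ.below X).card : ℝ) / (X : ℝ) ^ ((2 : ℝ) / 3))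
          Filter.atTop (nhds (V * c))

namespace thm9_1_F2_eulerProduct

/-! ### §1 The sieved families `F₂^{(Y)} = {a ∈ F₂ : p² ∤ Δ(a) for every prime p ≥ Y}` -/

/-- The member `(a₁, a₂, a₂', a₃) = (1, 1, −1, 0)` of `F₂` is `y² + xy = x³ − x` (`[1, 0, 0, −1, 0]`),
of discriminant `65 = 5 · 13`, square-free: no prime square divides it.
[cite: BhargavaHo2022, §1 (definition of F₂ and of its discriminant polynomial)] -/
theorem not_sq_dvd_Δ_witness (p : ℕ) (hp : p.Prime) :
    ¬ ((p : ℤ) ^ 2 ∣ (⟨1, 1, -1, 0⟩ : Params).curveInt.Δ) := by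
  have hΔ : (⟨1, 1, -1, 0⟩ : Params).curveInt.Δ = 65 := by
    have hc : (⟨1, 1, -1, 0⟩ : Params).curveInt = ⟨1, 0, 0, -1, 0⟩ := by simp [Params.curveInt]
    rw [hc]
    simp [WeierstrassCurve.Δ, WeierstrassCurve.b₂, WeierstrassCurve.b₄, WeierstrassCurve.b₆,
      WeierstrassCurve.b₈]
  have h65 : Squarefree (65 : ℤ) := by
    rw [← Int.squarefree_natAbs, show Int.natAbs 65 = 5 * 13 by norm_num]
    have sf : ∀ {q : ℕ}, q.Prime → Squarefree q := fun hq ↦ Irreducible.squarefree hq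
    exact (Nat.squarefree_mul (by norm_num)).mpr ⟨sf (by norm_num), sf (by norm_num)⟩
  rw [hΔ, sq]
  intro h
  have hu := h65 (p : ℤ) h
  rw [Int.ofNat_isUnit, Nat.isUnit_iff] at hu
  exact hp.one_lt.ne' hu

/-- **The sieved families** `F₂^{(Y)} ⊆ F₂` (`Y : ℕ`): no condition at the primes `p < Y`, and
«`p² ∤ Δ(a)`» (a condition on `a mod p²`) at the primes `p ≥ Y`; each is large (at EVERY prime),
has nonempty local conditions, membership CHARACTERISED by «`Δ(a) ≠ 0 ∧ ∀ p ≥ Y prime, p² ∤ Δ(a)`»,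
and local densities `#(residues p)/p^{4·expt p}` equal to `1` at `p < Y` and to those of `F₂^{(0)}`
at `p ≥ Y`. [cite: BhargavaHo2022, §1 (large subfamilies) and §9.1 (square-free discriminants)] -/
theorem exists_sievedFamilies : ∃ 𝓕 : ℕ → CongruenceFamily₂, ∀ Y : ℕ,
    (𝓕 Y).IsLarge ∧ (∀ p : ℕ, p.Prime → ((𝓕 Y).residues p).Nonempty) ∧
    (∀ a : Params, (𝓕 Y).Mem a ↔
      a.IsMember ∧ ∀ p : ℕ, Y ≤ p → p.Prime → ¬ ((p : ℤ) ^ 2 ∣ a.curveInt.Δ)) ∧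
    (∀ p : ℕ, p.Prime → p < Y →
      ((((𝓕 Y).residues p).ncard : ℝ) / ((p : ℝ) ^ (𝓕 Y).expt p) ^ 4) = 1) ∧
    (∀ p : ℕ, Y ≤ p →
      ((((𝓕 Y).residues p).ncard : ℝ) / ((p : ℝ) ^ (𝓕 Y).expt p) ^ 4) =
        (((𝓕 0).residues p).ncard : ℝ) / ((p : ℝ) ^ (𝓕 0).expt p) ^ 4) := by
  -- the families: modulus `p²` everywhere; residues `univ` below `Y`, `{ρ : p² ∤ Δ(ρ)}` from `Y` on
  let S : (p : ℕ) → Set (ZMod (p ^ 2) × ZMod (p ^ 2) × ZMod (p ^ 2) × ZMod (p ^ 2)) := fun p ↦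
    {ρ | ∃ b : Params, ((b.a₁ : ZMod (p ^ 2)) = ρ.1 ∧ (b.a₂ : ZMod (p ^ 2)) = ρ.2.1 ∧
      (b.a₂' : ZMod (p ^ 2)) = ρ.2.2.1 ∧ (b.a₃ : ZMod (p ^ 2)) = ρ.2.2.2) ∧
      ¬ ((p : ℤ) ^ 2 ∣ b.curveInt.Δ)}
  let 𝓕 : ℕ → CongruenceFamily₂ := fun Y ↦ ⟨fun _ ↦ 2, fun p ↦ if p < Y then Set.univ else S p⟩
  -- the residue condition at `p ≥ Y` IS `p² ∤ Δ(a)` (class-constancy of `p² ∣ Δ`)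
  have hS : ∀ (p : ℕ) (a : Params) (Y : ℕ), (𝓕 Y).residueOf p a ∈ S p ↔
      ¬ ((p : ℤ) ^ 2 ∣ a.curveInt.Δ) := fun p a Y ↦ by
    constructor
    · rintro ⟨b, ⟨h₁, h₂, h₂', h₃⟩, hb⟩
      -- class-constancy of `p² ∣ Δ` (the cell's `Rank2.F2Member.dvd_Δ_iff_of_cast_eq`, Summits-side)
      have hmap : b.curveInt.map (Int.castRingHom (ZMod (p ^ 2))) =
          a.curveInt.map (Int.castRingHom (ZMod (p ^ 2))) := by
        ext <;> simp [Params.curveInt, WeierstrassCurve.map, h₁, h₂, h₂', h₃, CongruenceFamily₂.residueOf]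
      have hΔ := congrArg WeierstrassCurve.Δ hmap
      simp only [WeierstrassCurve.map_Δ, eq_intCast] at hΔ
      have hiff : (((p ^ 2 : ℕ) : ℤ) ∣ b.curveInt.Δ) ↔ (((p ^ 2 : ℕ) : ℤ) ∣ a.curveInt.Δ) := by
        rw [← ZMod.intCast_zmod_eq_zero_iff_dvd, ← ZMod.intCast_zmod_eq_zero_iff_dvd, hΔ]
      push_cast at hiff
      rwa [hiff] at hb
    · intro ha
      exact ⟨a, ⟨rfl, rfl, rfl, rfl⟩, ha⟩
  refine ⟨𝓕, fun Y ↦ ⟨?_, ?_, ?_, ?_, ?_⟩⟩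
  · -- large at every prime
    refine ⟨0, fun p _ _ a _ hnd ↦ ?_⟩
    show (𝓕 Y).residueOf p a ∈ (if p < Y then Set.univ else S p)
    split_ifs
    · exact Set.mem_univ _
    · exact (hS p a Y).mpr hnd
  · -- nonempty local conditions: the member `(1, 1, -1, 0)` (`Δ = 65`) passes everywhere
    intro p hp
    refine ⟨(𝓕 Y).residueOf p ⟨1, 1, -1, 0⟩, ?_⟩
    show (𝓕 Y).residueOf p ⟨1, 1, -1, 0⟩ ∈ (if p < Y then Set.univ else S p)
    split_ifs
    · exact Set.mem_univ _
    · exact (hS p _ Y).mpr (not_sq_dvd_Δ_witness p hp)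
  · -- membership
    intro a
    constructor
    · rintro ⟨ha, hres⟩
      refine ⟨ha, fun p hYp hp ↦ ?_⟩
      have h : (𝓕 Y).residueOf p a ∈ (if p < Y then Set.univ else S p) := hres p hp
      rw [if_neg (not_lt.mpr hYp)] at h
      exact (hS p a Y).mp h
    · rintro ⟨ha, hsf⟩
      refine ⟨ha, fun p hp ↦ ?_⟩
      show (𝓕 Y).residueOf p a ∈ (if p < Y then Set.univ else S p)
      split_ifs with hlt
      · exact Set.mem_univ _
      · exact (hS p a Y).mpr (hsf p (not_lt.mp hlt) hp)
  · -- local density `1` below `Y`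
    intro p hp hlt
    show (((if p < Y then Set.univ else S p) : Set _).ncard : ℝ) / ((p : ℝ) ^ 2) ^ 4 = 1
    rw [if_pos hlt, Set.ncard_univ]
    haveI : NeZero (p ^ 2) := ⟨pow_ne_zero 2 hp.ne_zero⟩
    simp only [Nat.card_prod, Nat.card_zmod]
    have hp0 : (p : ℝ) ≠ 0 := by exact_mod_cast hp.ne_zero
    push_cast
    field_simp
  · -- local densities at `p ≥ Y` do not depend on `Y`
    intro p hYp
    show (((if p < Y then Set.univ else S p) : Set _).ncard : ℝ) / ((p : ℝ) ^ 2) ^ 4 =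
      (((if p < 0 then Set.univ else S p) : Set _).ncard : ℝ) / ((p : ℝ) ^ 2) ^ 4
    rw [if_neg (not_lt.mpr hYp), if_neg (Nat.not_lt_zero p)]

/-! ### §2 The tail set is `F₂(<X) ∖ F₂^{(Y)}(<X)` -/

/-- For a family `Φ` whose membership is «`Δ ≠ 0 ∧ ∀ p ≥ Y prime, p² ∤ Δ`», the members of `F₂(<X)`
with `p² ∣ Δ` for some prime `p ≥ Y` are exactly `F₂(<X) ∖ Φ(<X)`. [folklore] -/
private theorem tail_eq_sdiff {Φ : CongruenceFamily₂} {Y : ℕ}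
    (hmem : ∀ a : Params, Φ.Mem a ↔
      a.IsMember ∧ ∀ p : ℕ, Y ≤ p → p.Prime → ¬ ((p : ℤ) ^ 2 ∣ a.curveInt.Δ)) (X : ℕ) :
    ((CongruenceFamily₂.all.below X).filter fun a ↦
        ∃ p : ℕ, Y ≤ p ∧ p.Prime ∧ (p : ℤ) ^ 2 ∣ a.curveInt.Δ) =
      CongruenceFamily₂.all.below X \ Φ.below X := by
  ext a
  simp only [Finset.mem_filter, Finset.mem_sdiff, CongruenceFamily₂.mem_below_iff,
    CongruenceFamily₂.mem_all_iff, hmem]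
  constructor
  · rintro ⟨⟨ha, hX⟩, p, hYp, hp, hdvd⟩
    exact ⟨⟨ha, hX⟩, fun h ↦ h.1.2 p hYp hp hdvd⟩
  · rintro ⟨⟨ha, hX⟩, hnot⟩
    refine ⟨⟨ha, hX⟩, ?_⟩
    by_contra hcon
    exact hnot ⟨⟨ha, fun p hYp hp hdvd ↦ hcon ⟨p, hYp, hp, hdvd⟩⟩, hX⟩

/-- Hence the tail count is `#F₂(<X) − #Φ(<X)` (as reals). [folklore] -/
private theorem card_tail_eq {Φ : CongruenceFamily₂} {Y : ℕ}
    (hmem : ∀ a : Params, Φ.Mem a ↔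
      a.IsMember ∧ ∀ p : ℕ, Y ≤ p → p.Prime → ¬ ((p : ℤ) ^ 2 ∣ a.curveInt.Δ)) (X : ℕ) :
    ((((CongruenceFamily₂.all.below X).filter fun a ↦
        ∃ p : ℕ, Y ≤ p ∧ p.Prime ∧ (p : ℤ) ^ 2 ∣ a.curveInt.Δ).card : ℕ) : ℝ) =
      ((CongruenceFamily₂.all.below X).card : ℝ) - ((Φ.below X).card : ℝ) := by
  rw [tail_eq_sdiff hmem X]
  have h' : (((CongruenceFamily₂.all.below X \ Φ.below X).card : ℕ) : ℝ) + ((Φ.below X).card : ℝ) =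
      ((CongruenceFamily₂.all.below X).card : ℝ) := by
    exact_mod_cast Finset.card_sdiff_add_card_eq_card (Φ.below_subset_all_below X)
  linarith

/-! ### §3 Consequences of Thm. 9.1 with its constant: the tree's `thm9_1_F2`, relative densities,
and the TAIL ESTIMATE -/

/-- The tree's transcription `thm9_1_F2` (positivity of the main-term constant only) is a corollary of
the printed theorem with its constant. [cite: BhargavaHo2022, Thm. 9.1 (§9.1, p. 31)] -/
theorem thm9_1 (h : thm9_1_F2_eulerProduct) : thm9_1_F2 := fun Φ hL hne ↦ by
  obtain ⟨V, hV, hΦ⟩ := h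
  obtain ⟨c, hc, -, ht⟩ := hΦ Φ hL hne
  exact ⟨V * c, mul_pos hV hc, ht⟩

/-- The local density of the whole family `F₂` is `1` at every `p` (no condition: `expt = 0`,
`residues = univ`), so its density function is the constant `1`. [cite: BhargavaHo2022, §8.2 (M_p(F) = 1)] -/
theorem density_all_eq_one (p : ℕ) :
    (if p.Prime then (((CongruenceFamily₂.all.residues p).ncard : ℝ) /
      ((p : ℝ) ^ CongruenceFamily₂.all.expt p) ^ 4) else 1) = 1 := by
  split_ifs with hp
  · have hres : (CongruenceFamily₂.all.residues p).ncard = 1 := by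
      show (Set.univ : Set (ZMod (p ^ 0) × ZMod (p ^ 0) × ZMod (p ^ 0) × ZMod (p ^ 0))).ncard = 1
      rw [Set.ncard_univ]
      simp only [Nat.card_prod, Nat.card_zmod, pow_zero, mul_one]
    have hexpt : CongruenceFamily₂.all.expt p = 0 := rfl
    rw [hres, hexpt]
    simp
  · rfl

/-- **The counting function of `F₂` itself**: `#F₂(<X) / X^{2/3} → V` (the Euler product of `F₂` is
`1`). [cite: BhargavaHo2022, Thm. 9.1 (§9.1, p. 31), for Φ = F] -/
theorem card_all_below_tendsto {V : ℝ}
    (hΦ : ∀ Φ : CongruenceFamily₂, Φ.IsLarge → (∀ p : ℕ, p.Prime → (Φ.residues p).Nonempty) →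
      ∃ c : ℝ, 0 < c ∧
        HasProd (fun p : ℕ ↦ if p.Prime then
            ((Φ.residues p).ncard : ℝ) / ((p : ℝ) ^ Φ.expt p) ^ 4 else 1) c ∧
        Tendsto (fun X : ℕ ↦ ((Φ.below X).card : ℝ) / (X : ℝ) ^ ((2 : ℝ) / 3)) atTop (𝓝 (V * c))) :
    Tendsto (fun X : ℕ ↦ ((CongruenceFamily₂.all.below X).card : ℝ) / (X : ℝ) ^ ((2 : ℝ) / 3))
      atTop (𝓝 V) := by
  obtain ⟨c, -, hprod, ht⟩ := hΦ CongruenceFamily₂.all CongruenceFamily₂.isLarge_all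
    fun p _ ↦ CongruenceFamily₂.residues_all_nonempty p
  have hfun : (fun p : ℕ ↦ if p.Prime then (((CongruenceFamily₂.all.residues p).ncard : ℝ) /
      ((p : ℝ) ^ CongruenceFamily₂.all.expt p) ^ 4) else 1) = fun _ ↦ (1 : ℝ) :=
    funext density_all_eq_one
  rw [hfun] at hprod
  have hc1 : c = 1 := hprod.unique hasProd_one
  rw [hc1, mul_one] at ht
  exact ht

/-- **Relative density = Euler product** (modulo Thm. 9.1 with its constant): for a large `Φ` with
nonempty local conditions, `#Φ(<X) / #F₂(<X) → ∏_p M_p(Φ) > 0`.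
[cite: BhargavaHo2022, Thm. 9.1 (§9.1, p. 31), applied to Φ and to F] -/
theorem relativeDensity (h : thm9_1_F2_eulerProduct) (Φ : CongruenceFamily₂)
    (hL : Φ.IsLarge) (hne : ∀ p : ℕ, p.Prime → (Φ.residues p).Nonempty) :
    ∃ c : ℝ, 0 < c ∧
      HasProd (fun p : ℕ ↦ if p.Prime then
          ((Φ.residues p).ncard : ℝ) / ((p : ℝ) ^ Φ.expt p) ^ 4 else 1) c ∧
      Tendsto (fun X : ℕ ↦ ((Φ.below X).card : ℝ) / ((CongruenceFamily₂.all.below X).card : ℝ))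
        atTop (𝓝 c) := by
  obtain ⟨V, hV, hΦ⟩ := h
  obtain ⟨c, hc, hprod, ht⟩ := hΦ Φ hL hne
  have hall := card_all_below_tendsto hΦ
  refine ⟨c, hc, hprod, ?_⟩
  have hdiv := ht.div hall hV.ne'
  rw [mul_div_cancel_left₀ c hV.ne'] at hdiv
  refine hdiv.congr' ?_
  filter_upwards [eventually_ge_atTop 1] with X hX
  have hXpos : (0 : ℝ) < (X : ℝ) ^ ((2 : ℝ) / 3) := Real.rpow_pos_of_pos (by exact_mod_cast hX) _
  rw [Pi.div_apply, div_div_div_cancel_right₀ hXpos.ne']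

/-- **The sieved densities tend to `1`.** If `c : ℕ → ℝ` are the Euler products of density functions
`f Y` with `f Y p = 1` for `p < Y` and `f Y p = f 0 p` for `p ≥ Y`, and `c 0 > 0`, then `c Y → 1`:
`c 0 = c Y · ∏_{p < Y} f 0 p` and the partial products `∏_{p < Y} f 0 p → c 0`. [folklore] -/
private theorem sievedDensity_tendsto_one {f : ℕ → ℕ → ℝ} {c : ℕ → ℝ}
    (hprod : ∀ Y : ℕ, HasProd (f Y) (c Y)) (hc0 : 0 < c 0)
    (hlow : ∀ Y p : ℕ, p < Y → f Y p = 1) (hhigh : ∀ Y p : ℕ, Y ≤ p → f Y p = f 0 p) :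
    Tendsto c atTop (𝓝 1) := by
  -- `c 0 = c Y * ∏_{p < Y} f 0 p`
  have hsplit : ∀ Y : ℕ, c 0 = c Y * ∏ p ∈ Finset.range Y, f 0 p := fun Y ↦ by
    set g : ℕ → ℝ := fun p ↦ if p < Y then f 0 p else 1 with hg
    have hgprod : HasProd g (∏ p ∈ Finset.range Y, g p) :=
      hasProd_prod_of_ne_finset_one fun p hp ↦ by simp [hg, Finset.mem_range.not.mp hp]
    have hgeq : ∏ p ∈ Finset.range Y, g p = ∏ p ∈ Finset.range Y, f 0 p :=
      Finset.prod_congr rfl fun p hp ↦ by simp [hg, Finset.mem_range.mp hp]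
    rw [hgeq] at hgprod
    have hmul := (hprod Y).mul hgprod
    have hfg : (fun p ↦ f Y p * g p) = f 0 := funext fun p ↦ by
      by_cases hp : p < Y
      · rw [hlow Y p hp, one_mul]; simp [hg, hp]
      · rw [hhigh Y p (not_lt.mp hp)]; simp [hg, hp]
    rw [hfg] at hmul
    exact (hprod 0).unique hmul
  -- the partial products tend to `c 0 ≠ 0`
  have hP : Tendsto (fun Y ↦ ∏ p ∈ Finset.range Y, f 0 p) atTop (𝓝 (c 0)) :=
    (hprod 0).tendsto_prod_nat
  have hceq : c = fun Y ↦ c 0 / ∏ p ∈ Finset.range Y, f 0 p := funext fun Y ↦ by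
    have hPne : ∏ p ∈ Finset.range Y, f 0 p ≠ 0 := by
      intro h0
      rw [hsplit Y, h0, mul_zero] at hc0
      exact lt_irrefl 0 hc0
    exact (eq_div_iff hPne).mpr (hsplit Y).symm
  rw [hceq]
  have h := (tendsto_const_nhds (x := c 0)).div hP hc0.ne'
  rwa [div_self hc0.ne'] at h

/-- **The `p² ∣ Δ` TAIL ESTIMATE for `F₂`, from Thm. 9.1 with its constant.** For every `η > 0` there
is `Y` such that, eventually in `X`, the members of `F₂(<X)` with `p² ∣ Δ` for some prime `p ≥ Y`
number at most `η · #F₂(<X)` — the hypothesis `htail` of the tree's sieve reductions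
`Theorems.averageOnLE_of_isLarge_of_truncations` / `Theorems.densityOnGE_of_isLarge_of_truncations`.
Proof: the tail is `F₂(<X) ∖ F₂^{(Y)}(<X)`, of relative density `1 − c_Y` with
`c_Y = ∏_{p ≥ Y} M_p(F₂^{(2)}) → 1`. [cite: BhargavaHo2022, Thm. 9.1 and Prop. 9.2 (§9.1, p. 31)] -/
theorem tail_estimate (h : thm9_1_F2_eulerProduct) :
    ∀ η : ℝ, 0 < η → ∃ Y : ℕ, ∀ᶠ X : ℕ in atTop,
      (((CongruenceFamily₂.all.below X).filter fun a ↦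
          ∃ p : ℕ, Y ≤ p ∧ p.Prime ∧ (p : ℤ) ^ 2 ∣ a.curveInt.Δ).card : ℝ) ≤
        η * (CongruenceFamily₂.all.below X).card := by
  intro η hη
  obtain ⟨𝓕, h𝓕⟩ := exists_sievedFamilies
  -- Euler products and relative densities of the sieved families
  choose c hc hprod hratio using fun Y ↦ relativeDensity h (𝓕 Y) (h𝓕 Y).1 (h𝓕 Y).2.1
  -- `c Y → 1`
  have hc1 : Tendsto c atTop (𝓝 1) := by
    refine sievedDensity_tendsto_one hprod (hc 0) (fun Y p hp ↦ ?_) fun Y p hp ↦ ?_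
    · by_cases hpr : p.Prime
      · rw [if_pos hpr]; exact (h𝓕 Y).2.2.2.1 p hpr hp
      · rw [if_neg hpr]
    · by_cases hpr : p.Prime
      · rw [if_pos hpr, if_pos hpr]; exact (h𝓕 Y).2.2.2.2 p hp
      · rw [if_neg hpr, if_neg hpr]
  -- choose `Y` with `1 - c Y < η / 2`
  obtain ⟨Y, hY⟩ := (hc1.eventually (Ioi_mem_nhds (show 1 - η / 2 < 1 by linarith))).exists
  refine ⟨Y, ?_⟩
  -- eventually the tail has relative density `< η`
  have hlim : Tendsto (fun X : ℕ ↦ 1 - (((𝓕 Y).below X).card : ℝ) /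
      ((CongruenceFamily₂.all.below X).card : ℝ)) atTop (𝓝 (1 - c Y)) :=
    (tendsto_const_nhds (x := (1 : ℝ))).sub (hratio Y)
  have hev : ∀ᶠ X : ℕ in atTop, 1 - (((𝓕 Y).below X).card : ℝ) /
      ((CongruenceFamily₂.all.below X).card : ℝ) < η :=
    hlim.eventually (Iio_mem_nhds (by
      have hY' : 1 - η / 2 < c Y := hY
      linarith))
  filter_upwards [hev] with X hX
  rw [card_tail_eq (h𝓕 Y).2.2.1 X]
  have hA : (0 : ℝ) ≤ (((𝓕 Y).below X).card : ℝ) := Nat.cast_nonneg _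
  have hAB : (((𝓕 Y).below X).card : ℝ) ≤ ((CongruenceFamily₂.all.below X).card : ℝ) := by
    exact_mod_cast Finset.card_le_card ((𝓕 Y).below_subset_all_below X)
  set A : ℝ := (((𝓕 Y).below X).card : ℝ)
  set B : ℝ := ((CongruenceFamily₂.all.below X).card : ℝ)
  rcases (hA.trans hAB).eq_or_lt with h0 | hpos
  · rw [← h0] at hAB ⊢
    nlinarith
  · have hmul := mul_lt_mul_of_pos_right hX hpos
    rw [sub_mul, one_mul, div_mul_cancel₀ A hpos.ne'] at hmul
    exact hmul.le

end thm9_1_F2_eulerProduct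

end Literature.NumberTheory.EllipticCurves.BhargavaHo2022

end
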